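import Summits.BirchSwinnertonDyer.Rank1Residual.X2.IsogenyClassStability
import Literature.NumberTheory.EllipticCurves.Rank1Residual.GVParityTwistTransportProofs
import Literature.NumberTheory.EllipticCurves.AnomalousOfRationalTorsionProofs
import Literature.NumberTheory.EllipticCurves.MazurTorsionGaloisStructureProofs
import HarnessLib

/-!
# The Greenberg–Vatsal parity type at an odd MULTIPLICATIVE prime: independent of the rational
# line, forced to type A by a rational `p`-torsion point anywhere in the isogeny class, swapped by
# odd quadratic twists unramified at `p` (cell `b2b-bsdres`; off-peak typer `lit-cgls`, session 9 —
# elementary reductions for CLASS-CLOSURE-PLAN §3.7 O9 / §3.15 N9, columns 'gvpar' / 'p ∣ #tors' of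
# the E2 hypothesis table and the E3 'twist links')

HONEST FRAMING (run/shared/lean/b2b/bsd-rank1-residual/, verbatim in every file): the goal of the
cell is to DELETE the COMBINATION-SHAPED residual classes of the Birch–Swinnerton-Dyer formula for
ALL analytic-rank `≤ 1` elliptic curves over `ℚ` — "full BSD formula for every rank `≤ 1` curve in
class `C`" assembled STRICTLY from published theorems — so that the rank-`≤ 1` remainder becomes
exactly the CONSTRUCTION-SHAPED classes, which are TYPED (missing-input `Prop`s), NOT attempted.
This is not "finishing BSD". Research route; NO CLAIM BEYOND STATED CLASSES; nothing here changes
a label; nothing is booked. THEOREMS ONLY (no definition, no named fact, no `sorry`).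

## What

The sub-partition of the multiplicative Eisenstein class X2 (`p` odd, `E[p]` reducible, `p ‖ N`)
into X2a = `r = 0 ∧ gvpar` (CLOSED, `X2/RankZero.lean`), X2b = `r = 0 ∧ ¬gvpar`, X2c = `r = 1`
(`X2/Cells.lean`) is cut by the Greenberg–Vatsal parity type `GVPar W p` (some rational `p`-isogeny
kernel is ramified-at-`p`-and-even or unramified-at-`p`-and-odd). At a GOOD ORDINARY prime x1a
proved (`Rank1Residual/GVParityLineTypeProofs.lean`, `…TwistTransportProofs.lean`,
`…IsogenyClassProofs.lean`) that the type does not depend on the kernel, that a rational point of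
order `p` anywhere in the `ℚ`-isogeny class forces type A, and that an odd quadratic twist
unramified at `p` swaps A and B — all from Serre's ordinary line (hL) and the Weil-pairing signs
(hc) through the hypothesis-explicit lemma `gvType_of_isRationalLine_of_ordinaryLine`. Session 8
(`X2/IsogenyClassStability.lean`) supplied (hL) at an odd MULTIPLICATIVE prime — the Tate line
`C[p] ≅ μ_p` at every prime of `\bar ℤ` above `p` (`X2.exists_tateLine`, from eisenstein-p2's
one-prime `exists_tateLine_adicCompletionPrime` and the Tate-uniformisation named facts `hT`, `hT'`
= Silverman *ATAEC* V.5.3 / V.5.4, as everywhere in the X2 kernel). This file runs x1a's three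
arguments on that line:

* §1 `gvType_iff_of_isRationalLine_of_mult` — **at an odd multiplicative `p` the GV type of a
  rational line does not depend on the line**; `not_gvPar_of_isRationalLine_of_mult` (one co-type
  line ⇒ type A);
* §2 `not_gvPar_of_nsmul_eq_zero_of_mult` — **a rational point of order `p` forces type A at an odd
  multiplicative `p`** (its line is unramified and even); `not_gvPar_of_dvd_torsionOrder_of_mult`
  (`p ∣ #E(ℚ)_tors` form); `not_gvPar_of_isIsogenous_of_nsmul_eq_zero_of_mult` /
  `not_gvPar_of_isIsogenous_of_dvd_torsionOrder_of_mult` — the same with the torsion point on ANY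
  curve of the `ℚ`-isogeny class (session 8's `gvPar_iff_of_isIsogenous_of_mult`); census reading
  `classX2_of_mult_of_dvd_torsionOrder` (a rational `p`-torsion point makes `(E,p)` an X2 pair at an
  odd multiplicative `p`), **`cellB_of_mult_of_dvd_torsionOrder`** (`r_an = 0`: the pair is in the
  OPEN sub-cell X2b, never in the Greenberg–Vatsal cell X2a — `not_cellA_of_isIsogenous_of_dvd_torsionOrder`
  for a torsion point anywhere in the class) and `cellC_not_gvPar_of_mult_of_dvd_torsionOrder`
  (`r_an = 1`: the `¬gvpar` strand of X2c, whose admissible twists land in X2a —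
  `X2/RankOne.lean`'s `pPartRankZero_twist_of_not_gvPar`);
* §3 `gvPar_twist_iff_not_gvPar_of_neg_of_mult` — **an odd quadratic twist unramified at `p`
  (`d < 0`, `p ∤ d`) swaps type A and type B at an odd multiplicative prime** (iff form of the
  one-directional `gvPar_of_not_gvPar_of_twist` used by `X2/RankOne.lean`); the even-twist law
  `gvPar_twist_iff_of_pos` (`d > 0`, `p ∤ d`: type preserved) is x1a's and needs no reduction
  hypothesis, and so does its `gvPar_of_twist_neg_of_nsmul_eq_zero` (a rational point of order `p`
  on the odd twist makes `E` of type B).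

So in the E2 hypothesis table of N9 / O9 the column 'gvpar' is DETERMINED by the column
'`p ∣ #E'(ℚ)_tors` for some `E'` in the class' wherever the latter is YES (then type A: X2b or the
`¬gvpar` strand of X2c), with no Galois computation; and the E3 twist links at `p ∤ d` move an X2
pair to type A ↔ B according to the sign of `d` alone. Inputs, all theorems of the tree except the
two Tate-uniformisation named facts `hT`, `hT'` (A40/A41): `X2.exists_tateLine`,
`gvType_of_isRationalLine_of_ordinaryLine`, `exists_fixed_and_antifixed_of_isComplexConjugation`,
`exists_isRationalLine_of_nsmul_eq_zero`, `gvPar_twist_iff_exists_coType_of_neg`,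
`exists_addOrderOf_eq_of_dvd_torsionOrder`, `not_hasIrreducibleModPGaloisRep_of_addOrderOf_eq`.
Nothing about any particular curve is asserted.

References: [GreenbergVatsal2000] Thm. (1.3) (the parity condition) and the remark after it
(even twists prime to `p` preserve the hypotheses), §2 p. 28, pp. 14–15; [CastellaEtAl2021] proof
of Thm. 5.3.1, last paragraph (`E ↦ E^K` swaps the parity); [SilvermanATAEC1994] Thm. V.5.3,
Cor. V.5.4; [SilvermanAEC2009] X.5 Cor. 5.4, VII.3; HOME/CLASS-CLOSURE-PLAN.md §3.7, §3.15;
HOME/b2b-bsdres-lit-cgls/CGLS-GV-TYPING.md §16.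
-/

set_option autoImplicit false

noncomputable section

open scoped Classical

open WeierstrassCurve Literature.NumberTheory.EllipticCurves Literature.NumberTheory.GaloisRepresentations
  Field IsDedekindDomain NumberField
  Literature.NumberTheory.EllipticCurves.Rank1Residual

namespace Summit.BirchSwinnertonDyer.Rank1Residual.X2

variable {W W' Wd : WeierstrassCurve ℚ} {p : ℕ} [hp : Fact p.Prime]

/-! ## §1. The type of a rational line does not depend on the line (odd multiplicative `p`) -/

section LineType

variable [W.IsElliptic] [W.IsGloballyMinimal]

/-- **The Greenberg–Vatsal type of a rational `p`-isogeny kernel does not depend on the kernel at an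
odd MULTIPLICATIVE prime** (globally minimal `W`, granted the Tate-uniformisation facts `hT`, `hT'`):
for rational lines `Φ₁, Φ₂ ≤ E[p]`, `Φ₁` is (ramified ∧ even) ∨ (unramified ∧ odd) iff `Φ₂` is.
x1a's `gvType_of_isRationalLine_of_ordinaryLine` with (hL) = the Tate line (`exists_tateLine`) and
(hc) = the Weil-pairing signs. The multiplicative twin of `gvType_iff_of_isRationalLine`.
[cite: GreenbergVatsal2000, Thm. (1.3) and §2 p. 28] [cite: SilvermanATAEC1994, Thm. V.5.3 and Cor. V.5.4] -/
theorem gvType_iff_of_isRationalLine_of_mult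
    (hT : Silverman1994_thmV53_tateUniformisation.{0})
    (hT' : Silverman1994_thmV53_corV54_tateUniformisation.{0})
    (hp2 : p ≠ 2) (hmult : W.HasMultiplicativeReductionAtPrime p)
    {Φ₁ Φ₂ : AddSubgroup (geomTorsion W (p : ℤ))} (hΦ₁ : IsRationalLine W p Φ₁)
    (hΦ₂ : IsRationalLine W p Φ₂) :
    ((¬ LineUnramifiedAt W p Φ₁ ∧ LineEven W p Φ₁) ∨ (LineUnramifiedAt W p Φ₁ ∧ LineOdd W p Φ₁)) ↔
      ((¬ LineUnramifiedAt W p Φ₂ ∧ LineEven W p Φ₂) ∨ (LineUnramifiedAt W p Φ₂ ∧ LineOdd W p Φ₂)) :=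
  ⟨gvType_of_isRationalLine_of_ordinaryLine hp2 (Rank1Residual.natCard_geomTorsion W p)
      (exists_tateLine W p hT hT' hp2 hmult)
      (exists_fixed_and_antifixed_of_isComplexConjugation W hp2) hΦ₁ hΦ₂,
    gvType_of_isRationalLine_of_ordinaryLine hp2 (Rank1Residual.natCard_geomTorsion W p)
      (exists_tateLine W p hT hT' hp2 hmult)
      (exists_fixed_and_antifixed_of_isComplexConjugation W hp2) hΦ₂ hΦ₁⟩

/-- **One rational line of co-type makes the curve of type A at an odd multiplicative prime**
(globally minimal `W`, granted `hT`, `hT'`): if some rational line `Φ ≤ E[p]` is NOT of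
Greenberg–Vatsal type, then no rational line is: `¬ GVPar W p`. The multiplicative twin of
`not_gvPar_of_isRationalLine`. [cite: GreenbergVatsal2000, Thm. (1.3) and §2 p. 28] -/
theorem not_gvPar_of_isRationalLine_of_mult
    (hT : Silverman1994_thmV53_tateUniformisation.{0})
    (hT' : Silverman1994_thmV53_corV54_tateUniformisation.{0})
    (hp2 : p ≠ 2) (hmult : W.HasMultiplicativeReductionAtPrime p)
    {Φ : AddSubgroup (geomTorsion W (p : ℤ))} (hΦ : IsRationalLine W p Φ)
    (h : ¬ ((¬ LineUnramifiedAt W p Φ ∧ LineEven W p Φ) ∨ (LineUnramifiedAt W p Φ ∧ LineOdd W p Φ))) :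
    ¬ GVPar W p := by
  rintro ⟨Ψ, hΨ, hQ⟩
  exact h ((gvType_iff_of_isRationalLine_of_mult hT hT' hp2 hmult hΨ hΦ).mp hQ)

end LineType

/-! ## §2. A rational point of order `p` — anywhere in the isogeny class — forces type A -/

section Torsion

variable [W.IsElliptic] [W.IsGloballyMinimal]

variable (W) in
/-- **A rational point of order `p` forces type A at an odd multiplicative prime** (globally
minimal `W`, granted `hT`, `hT'`): the line spanned by `P ∈ E(ℚ)`, `P ≠ O`, `p • P = O` is fixed
pointwise by `Γ_ℚ`, hence unramified and even, i.e. of co-type (`exists_isRationalLine_of_nsmul_eq_zero`),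
so `¬ GVPar W p` (`not_gvPar_of_isRationalLine_of_mult`). The multiplicative twin of
`not_gvPar_of_nsmul_eq_zero` (e.g. the X2 pairs at `3` with a rational `3`-torsion point).
[cite: GreenbergVatsal2000, Thm. (1.3) and §2 p. 28] [cite: SilvermanATAEC1994, Thm. V.5.3 and Cor. V.5.4] -/
theorem not_gvPar_of_nsmul_eq_zero_of_mult
    (hT : Silverman1994_thmV53_tateUniformisation.{0})
    (hT' : Silverman1994_thmV53_corV54_tateUniformisation.{0})
    (hp2 : p ≠ 2) (hmult : W.HasMultiplicativeReductionAtPrime p)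
    (P : W.toAffine.Point) (hP0 : P ≠ 0) (hpP : p • P = 0) : ¬ GVPar W p := by
  obtain ⟨Φ, hΦ, -, hu, he⟩ := exists_isRationalLine_of_nsmul_eq_zero W P hP0 hpP
  refine not_gvPar_of_isRationalLine_of_mult hT hT' hp2 hmult hΦ ?_
  rintro (⟨hr, -⟩ | ⟨-, ho⟩)
  · exact hr hu
  · exact lineEven_lineOdd_false hp2 hΦ he ho

variable (W) in
/-- **`p ∣ #E(ℚ)_tors` forces type A at an odd multiplicative prime** (a point of order `p` exists
by Cauchy: `exists_addOrderOf_eq_of_dvd_torsionOrder`). [cite: GreenbergVatsal2000, Thm. (1.3) and §2 p. 28]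
[cite: SilvermanAEC2009, VII.3 Thm. 3.4] -/
theorem not_gvPar_of_dvd_torsionOrder_of_mult
    (hT : Silverman1994_thmV53_tateUniformisation.{0})
    (hT' : Silverman1994_thmV53_corV54_tateUniformisation.{0})
    (hp2 : p ≠ 2) (hmult : W.HasMultiplicativeReductionAtPrime p) (htors : p ∣ W.torsionOrder) :
    ¬ GVPar W p := by
  have hP : p.Prime := Fact.out
  obtain ⟨T, hTo⟩ := exists_addOrderOf_eq_of_dvd_torsionOrder W p htors
  have hT0 : T ≠ 0 := by
    rintro rfl
    rw [addOrderOf_zero] at hTo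
    exact hP.one_lt.ne hTo
  have hpT : p • T = 0 := by rw [← hTo]; exact addOrderOf_nsmul_eq_zero T
  exact not_gvPar_of_nsmul_eq_zero_of_mult W hT hT' hp2 hmult T hT0 hpT

variable [W'.IsElliptic] [W'.IsGloballyMinimal]

/-- **A rational point of order `p` ANYWHERE in the `ℚ`-isogeny class forces type A** at an odd
multiplicative prime (globally minimal `W, W'`, `IsIsogenous W W'`, `P ∈ E'(ℚ)` of order `p`;
granted `hT`, `hT'`): `W'` is multiplicative at `p` too (`hasMultiplicativeReductionAtPrime_of_isIsogenous`),
of type A by `not_gvPar_of_nsmul_eq_zero_of_mult`, and the type is an isogeny-class invariant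
(session 8's `gvPar_iff_of_isIsogenous_of_mult`). The multiplicative twin of
`not_gvPar_of_isIsogenous_of_nsmul_eq_zero`. [cite: GreenbergVatsal2000, Thm. (1.3) and §2 p. 28] -/
theorem not_gvPar_of_isIsogenous_of_nsmul_eq_zero_of_mult
    (hT : Silverman1994_thmV53_tateUniformisation.{0})
    (hT' : Silverman1994_thmV53_corV54_tateUniformisation.{0})
    (hp2 : p ≠ 2) (hmult : W.HasMultiplicativeReductionAtPrime p) (h : IsIsogenous W W')
    (P : W'.toAffine.Point) (hP0 : P ≠ 0) (hpP : p • P = 0) : ¬ GVPar W p := fun hG ↦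
  not_gvPar_of_nsmul_eq_zero_of_mult W' hT hT' hp2
    (IsogenyQuotientLine.hasMultiplicativeReductionAtPrime_of_isIsogenous h hmult) P hP0 hpP
    ((gvPar_iff_of_isIsogenous_of_mult hT hT' hp2 hmult h).mp hG)

/-- The `p ∣ #E'(ℚ)_tors` form of the previous theorem: `p`-torsion in the rational torsion of SOME
curve of the `ℚ`-isogeny class forces type A at an odd multiplicative `p`.
[cite: GreenbergVatsal2000, Thm. (1.3) and §2 p. 28] [cite: SilvermanAEC2009, VII.3 Thm. 3.4] -/
theorem not_gvPar_of_isIsogenous_of_dvd_torsionOrder_of_mult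
    (hT : Silverman1994_thmV53_tateUniformisation.{0})
    (hT' : Silverman1994_thmV53_corV54_tateUniformisation.{0})
    (hp2 : p ≠ 2) (hmult : W.HasMultiplicativeReductionAtPrime p) (h : IsIsogenous W W')
    (htors : p ∣ W'.torsionOrder) : ¬ GVPar W p := fun hG ↦
  not_gvPar_of_dvd_torsionOrder_of_mult W' hT hT' hp2
    (IsogenyQuotientLine.hasMultiplicativeReductionAtPrime_of_isIsogenous h hmult) htors
    ((gvPar_iff_of_isIsogenous_of_mult hT hT' hp2 hmult h).mp hG)

end Torsion

/-! ### Census readings: rational `p`-torsion puts an X2 pair in X2b (`r = 0`) or in the `¬gvpar`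
strand of X2c (`r = 1`), never in the Greenberg–Vatsal cell X2a -/

section Cells

variable [W.IsElliptic]

variable (W p) in
/-- **A rational point of order `p` at an odd multiplicative prime makes `(E, p)` an X2 pair**:
`E[p]` is reducible (the point spans a `Γ_ℚ`-stable line; tree
`not_hasIrreducibleModPGaloisRep_of_addOrderOf_eq`). No parity input. [folklore] -/
theorem classX2_of_mult_of_dvd_torsionOrder (hp2 : p ≠ 2)
    (hmult : W.HasMultiplicativeReductionAtPrime p) (htors : p ∣ W.torsionOrder) : ClassX2 W p := by
  obtain ⟨T, hTo⟩ := exists_addOrderOf_eq_of_dvd_torsionOrder W p htors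
  exact ⟨hp2, not_hasIrreducibleModPGaloisRep_of_addOrderOf_eq W hTo, hmult⟩

variable [W.IsGloballyMinimal]

variable (W p) in
/-- **X2b from rational torsion.** A globally minimal `W/ℚ` of analytic rank `0` with multiplicative
reduction at the odd prime `p` and `p ∣ #E(ℚ)_tors` is in sub-cell X2b (`r = 0 ∧ X2 ∧ ¬gvpar`) —
granted `hT`, `hT'`. So such pairs are NOT in the closed Greenberg–Vatsal cell X2a: their cyclotomic
`μ`-invariant is not controlled by [GV00] (the census's 'p ∣ #tors ⇒ ¬gvpar' column, kernel form).
[cite: GreenbergVatsal2000, Thm. (1.3) and §2 p. 28] [cite: SilvermanATAEC1994, Thm. V.5.3 and Cor. V.5.4] -/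
theorem cellB_of_mult_of_dvd_torsionOrder
    (hT : Silverman1994_thmV53_tateUniformisation.{0})
    (hT' : Silverman1994_thmV53_corV54_tateUniformisation.{0})
    (hp2 : p ≠ 2) (hmult : W.HasMultiplicativeReductionAtPrime p) (htors : p ∣ W.torsionOrder)
    (hr0 : W.analyticRank = 0) : CellB W p :=
  ⟨hr0, classX2_of_mult_of_dvd_torsionOrder W p hp2 hmult htors,
    not_gvPar_of_dvd_torsionOrder_of_mult W hT hT' hp2 hmult htors⟩

variable (W p) in
/-- **The `¬gvpar` strand of X2c from rational torsion**: analytic rank `1`, odd multiplicative `p`,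
`p ∣ #E(ℚ)_tors` ⟹ `CellC W p ∧ ¬ GVPar W p` (the strand whose admissible odd twists are of type B,
`X2/RankOne.lean`). Granted `hT`, `hT'`. [cite: GreenbergVatsal2000, Thm. (1.3) and §2 p. 28] -/
theorem cellC_not_gvPar_of_mult_of_dvd_torsionOrder
    (hT : Silverman1994_thmV53_tateUniformisation.{0})
    (hT' : Silverman1994_thmV53_corV54_tateUniformisation.{0})
    (hp2 : p ≠ 2) (hmult : W.HasMultiplicativeReductionAtPrime p) (htors : p ∣ W.torsionOrder)
    (hr1 : W.analyticRank = 1) : CellC W p ∧ ¬ GVPar W p :=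
  ⟨⟨hr1, classX2_of_mult_of_dvd_torsionOrder W p hp2 hmult htors⟩,
    not_gvPar_of_dvd_torsionOrder_of_mult W hT hT' hp2 hmult htors⟩

variable [W'.IsElliptic] [W'.IsGloballyMinimal]

/-- **No curve `ℚ`-isogenous to one with rational `p`-torsion is in the Greenberg–Vatsal cell X2a**
(odd multiplicative `p`; granted `hT`, `hT'`): if `p ∣ #E'(ℚ)_tors` for some `E'` in the class of
`E`, then `¬ CellA W p`. [cite: GreenbergVatsal2000, Thm. (1.3) and §2 p. 28] -/
theorem not_cellA_of_isIsogenous_of_dvd_torsionOrder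
    (hT : Silverman1994_thmV53_tateUniformisation.{0})
    (hT' : Silverman1994_thmV53_corV54_tateUniformisation.{0})
    (h : IsIsogenous W W') (htors : p ∣ W'.torsionOrder) : ¬ CellA W p := fun hA ↦
  not_gvPar_of_isIsogenous_of_dvd_torsionOrder_of_mult hT hT' hA.2.1.1 hA.2.1.2.2 h htors hA.2.2

end Cells

/-! ## §3. Odd twists unramified at `p` swap the type at an odd multiplicative prime -/

section Twist

variable [W.IsElliptic] [W.IsGloballyMinimal]

/-- **At an odd multiplicative prime an odd twist unramified at `p` swaps type A and type B**
(globally minimal `W` with `E[p]` reducible, `d < 0`, `p ∤ d`, `C • Wd = W.quadraticTwist d`;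
granted `hT`, `hT'`): `GVPar Wd p ↔ ¬ GVPar W p`. x1a's `gvPar_twist_iff_exists_coType_of_neg` (no
reduction hypothesis: `GVPar Wd p` iff `E` has a CO-type line) combined with §1 (a co-type line
makes `E` of type A; conversely on type A every rational line is of co-type, `coType_of_not_gvPar`).
The iff form, at `p ‖ N`, of the one-directional `gvPar_of_not_gvPar_of_twist` used in
`X2/RankOne.lean`; the multiplicative twin of `gvPar_twist_iff_not_gvPar_of_neg`.
[cite: CastellaEtAl2021, proof of Thm. 5.3.1 (last paragraph)] [cite: GreenbergVatsal2000, Thm. (1.3)] -/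
theorem gvPar_twist_iff_not_gvPar_of_neg_of_mult
    (hT : Silverman1994_thmV53_tateUniformisation.{0})
    (hT' : Silverman1994_thmV53_corV54_tateUniformisation.{0})
    (hp2 : p ≠ 2) (hmult : W.HasMultiplicativeReductionAtPrime p)
    (hred : ¬ W.HasIrreducibleModPGaloisRep p) {d : ℤ} (hd : d < 0) (hpd : ¬ (p : ℤ) ∣ d)
    (C : VariableChange ℚ) (hC : C • Wd = W.quadraticTwist ((d : ℤ) : ℚ)) :
    GVPar Wd p ↔ ¬ GVPar W p := by
  rw [gvPar_twist_iff_exists_coType_of_neg hp2 hd hpd C hC]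
  constructor
  · rintro ⟨Φ, hΦ, hQ⟩
    refine not_gvPar_of_isRationalLine_of_mult hT hT' hp2 hmult hΦ ?_
    rintro (⟨hr, he⟩ | ⟨hu, ho⟩)
    · rcases hQ with ⟨hu', -⟩ | ⟨-, ho'⟩
      · exact hr hu'
      · exact lineEven_lineOdd_false hp2 hΦ he ho'
    · rcases hQ with ⟨-, he'⟩ | ⟨hr', -⟩
      · exact lineEven_lineOdd_false hp2 hΦ he' ho
      · exact hr' hu
  · intro hA
    obtain ⟨Φ, hΦ⟩ := exists_isRationalLine_of_not_irr W p hred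
    exact ⟨Φ, hΦ, coType_of_not_gvPar hΦ hA⟩

/-- On class X2 (which carries `p ≠ 2`, `E[p]` reducible, `p ‖ N`): an odd twist unramified at `p`
swaps the Greenberg–Vatsal type (iff). Granted `hT`, `hT'`.
[cite: CastellaEtAl2021, proof of Thm. 5.3.1 (last paragraph)] [cite: GreenbergVatsal2000, Thm. (1.3)] -/
theorem gvPar_twist_iff_not_gvPar_of_classX2_of_neg
    (hT : Silverman1994_thmV53_tateUniformisation.{0})
    (hT' : Silverman1994_thmV53_corV54_tateUniformisation.{0})
    (hX : ClassX2 W p) {d : ℤ} (hd : d < 0) (hpd : ¬ (p : ℤ) ∣ d)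
    (C : VariableChange ℚ) (hC : C • Wd = W.quadraticTwist ((d : ℤ) : ℚ)) :
    GVPar Wd p ↔ ¬ GVPar W p :=
  gvPar_twist_iff_not_gvPar_of_neg_of_mult hT hT' hX.1 hX.2.2 hX.2.1 hd hpd C hC

end Twist

end Summit.BirchSwinnertonDyer.Rank1Residual.X2

end
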